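import Literature.NumberTheory.LFunctions.DeBruijnHHeatFlow
import HarnessLib

/-!
# de Bruijn's transform of `Φ/m`: the Pólya–de Bruijn kernel divided by a kernel multiplier

Topic `Literature/NumberTheory/LFunctions`, companion of `DeBruijnNewman.lean` (`Φ = deBruijnPhi`,
`H_t = deBruijnH t`, `HasOnlyRealZeros`) and of `DeBruijnNewmanProofs.lean` / `DeBruijnHHeatFlow.lean`
(domination by `deBruijnHBound`, moments, differentiation under the integral sign).

de Bruijn (1950, §1, eq. (1.5)), after Pólya (1927), studies the roots of the trigonometric
integrals `f(z) = ∫ F(t) e^{izt} dt` and calls `S(t)` a *universal factor* if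
`∫ F(t) S(t) e^{izt} dt` has real roots only whenever `∫ F(t) e^{izt} dt` has (Pólya's
classification: `S(t) = φ(it)` with `e^{-λz²}`-times-Laguerre–Pólya `φ`; for real even kernels
`S(u) = e^{λu²} ∏ₖ (1 + u²/aₖ²)`, `λ ≥ 0` — recalled for orientation only, nothing of it is used
or asserted here). Multiplying the kernel by `S` applies `S(−iD)` to the transform; Cardon
(2001, Thm. 3) reads the multiplier `L(t) = ∫ cosh(ts) dF(s)` as the convolution
`(G ∗ dF)(z) = ∫ G(z − is) dF(s)`. Route `RiemannHypothesis/UniversalFactor` works with the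
INVERSE operation on the Riemann kernel `Φ`: for a kernel multiplier `m : ℝ → ℝ`,

  `deBruijnHDiv m z = ∫₀^∞ (Φ(u) / m(u)) cos(z u) du`,

so that `m ≡ 1` gives `H_0(z) = ξ(1/2 + iz/2)/8` and `m(u) = 1 + u²/a²` gives the route's
Laplace-smoothed transform `F_a` (`1/(1 + u²/a²) = E[cos(uX)]` for `X ~ Laplace(a)`, so that
`F_a = E[H_0(· + X)]` and `(1 − D²/a²) F_a = H_0`).

## Contents (all proved)

* `deBruijnHDiv` (the definition, literally the integral inlined by the route's items, see
  `deBruijnHDiv_laplace_eq`), `deBruijnHDiv_one'`/`deBruijnHDiv_one` (`m ≡ 1` gives `H_0`),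
  `deBruijnHDiv_neg` (even in `z`), `conj_deBruijnHDiv`, `deBruijnHDiv_ofReal_im` (real on `ℝ`);
* `IsDivAdmissible m`: `m` is a.e. strongly measurable on `(0, ∞)` and `|m(u)|⁻¹ ≤ C e^{T u²}` there
  (then `Φ/m` has all exponential moments); closed under products; satisfied by `1`, by the
  Laplace multipliers `1 + u²/a²` (every real `a`) and by the Gaussian multipliers `e^{t u²}`;
* the moments `divCosMoment m k z = ∫₀^∞ uᵏ (Φ/m)(u) cos(zu) du`, `divSinMoment m k z` with
  `∂_z divCosMoment m k = −divSinMoment m (k+1)`, `∂_z divSinMoment m k = divCosMoment m (k+1)`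
  (dominated convergence, exactly as in `DeBruijnHHeatFlow.lean`);
* `IsDivAdmissible.differentiable_deBruijnHDiv`: `deBruijnHDiv m` is entire;
  `IsDivAdmissible.deriv_deriv_deBruijnHDiv`: `(deBruijnHDiv m)'' = −divCosMoment m 2`;
* `deBruijnHDiv_laplace_sub_deriv_deriv`: the ODE `F_a − F_a''/a² = H_0` for the Laplace
  multiplier (the identity `(1 − D²/a²) F_a = H_0` behind the route's item LaguerreLift), valid
  for every real `a` (for `a = 0` both corrections are Lean's junk `x/0 = 0` and the multiplier
  is `1`).

Not here (separate files): the convolution identity `F_a = H_0 ∗ (a/2)e^{−a|·|}` (Fubini and the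
Fourier transform of the Laplace density) and the complex continuation of `Φ` to `|Im u| < π/8`.

## References

* N. G. de Bruijn, *The roots of trigonometric integrals*, Duke Math. J. 17 (1950) 197–226, §1.
* D. A. Cardon, *Convolution operators and zeros of entire functions*, Proc. AMS 130 (2002)
  1725–1734, §1.
* E. C. Titchmarsh, *The theory of the Riemann zeta-function*, 2nd ed. (1986), §10.1.
-/

noncomputable section

open Complex MeasureTheory Set Filter
open scoped ComplexConjugate Topology

namespace Literature.NumberTheory.LFunctions

/-! ## The definition and its elementary properties -/

/-- de Bruijn's cosine transform of the Pólya–de Bruijn kernel `Φ` DIVIDED by a kernel multiplier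
`m : ℝ → ℝ`: `deBruijnHDiv m z = ∫₀^∞ (Φ(u)/m(u)) cos(zu) du` (a Bochner integral on `(0, ∞)`,
`= 0` if not integrable). For `m ≡ 1` this is `H_0` (`deBruijnHDiv_one`); for a universal factor
`m = S` (de Bruijn 1950, §1) it is the transform `F_S` with `H_0 = T_S F_S`; for `m(u) = 1 + u²/a²`
it is the Laplace-smoothed `F_a` of route `UniversalFactor`. Convenience definition; the
integral is de Bruijn's (1.5) for the even kernel `Φ/m`. [cite: Bruijn1950, §1 eq. (1.5)] -/
def deBruijnHDiv (m : ℝ → ℝ) (z : ℂ) : ℂ :=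
  ∫ u in Set.Ioi (0 : ℝ), ((deBruijnPhi u / m u : ℝ) : ℂ) * Complex.cos (z * u)

/-- Unfolding lemma. [folklore] -/
theorem deBruijnHDiv_eq (m : ℝ → ℝ) (z : ℂ) :
    deBruijnHDiv m z = ∫ u in Set.Ioi (0 : ℝ), ((deBruijnPhi u / m u : ℝ) : ℂ) * Complex.cos (z * u) :=
  rfl

/-- For the Laplace multiplier `m(u) = 1 + u²/a²`, `deBruijnHDiv m z` is *syntactically* the
integral inlined in the items of route `RiemannHypothesis/UniversalFactor` (so those restate by
`Iff.rfl`). [folklore] -/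
theorem deBruijnHDiv_laplace_eq (a : ℝ) (z : ℂ) :
    deBruijnHDiv (fun u : ℝ => 1 + u ^ 2 / a ^ 2) z =
      ∫ u in Set.Ioi (0 : ℝ), ((deBruijnPhi u / (1 + u ^ 2 / a ^ 2) : ℝ) : ℂ) * Complex.cos (z * u) :=
  rfl

/-- `m ≡ 1` gives de Bruijn's `H_0`: `deBruijnHDiv (fun _ ↦ 1) = deBruijnH 0`. [folklore] -/
theorem deBruijnHDiv_one' : deBruijnHDiv (fun _ : ℝ => (1 : ℝ)) = deBruijnH 0 := by
  funext z
  rw [deBruijnHDiv, deBruijnH]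
  refine setIntegral_congr_fun measurableSet_Ioi fun u _ ↦ ?_
  simp

/-- `m = 1` (the constant function) gives `H_0`. [folklore] -/
theorem deBruijnHDiv_one : deBruijnHDiv 1 = deBruijnH 0 :=
  deBruijnHDiv_one'

/-- `deBruijnHDiv m` is even in `z`, since `cos` is. [folklore] -/
theorem deBruijnHDiv_neg (m : ℝ → ℝ) (z : ℂ) : deBruijnHDiv m (-z) = deBruijnHDiv m z := by
  simp [deBruijnHDiv, neg_mul, Complex.cos_neg]

/-- The kernel is real, so `conj (deBruijnHDiv m z) = deBruijnHDiv m (conj z)`. [folklore] -/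
theorem conj_deBruijnHDiv (m : ℝ → ℝ) (z : ℂ) :
    conj (deBruijnHDiv m z) = deBruijnHDiv m (conj z) := by
  rw [deBruijnHDiv, deBruijnHDiv, ← integral_conj]
  refine setIntegral_congr_fun measurableSet_Ioi fun u _ ↦ ?_
  simp only [map_mul, Complex.conj_ofReal, ← Complex.cos_conj, map_mul, Complex.conj_ofReal]

/-- `deBruijnHDiv m` is real on the real axis. [folklore] -/
theorem deBruijnHDiv_ofReal_im (m : ℝ → ℝ) (x : ℝ) : (deBruijnHDiv m x).im = 0 := by
  have h := conj_deBruijnHDiv m x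
  rw [Complex.conj_ofReal] at h
  exact Complex.conj_eq_iff_im.1 h

/-! ## Admissible multipliers -/

/-- Admissibility of a kernel multiplier `m` for `deBruijnHDiv`: `m` is a.e. strongly measurable on
`(0, ∞)` and `1/m` has at most Gaussian growth there, `|m(u)|⁻¹ ≤ C e^{T u²}` for `u > 0`. Then
`Φ/m` is dominated by `C e^{Tu²} Φ`, which has all exponential moments
(`integrableOn_deBruijnHBound`). All universal factors `e^{λu²} ∏ (1 + u²/aₖ²)` (any real `λ`)
qualify. [folklore] -/
structure IsDivAdmissible (m : ℝ → ℝ) : Prop where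
  aestronglyMeasurable : AEStronglyMeasurable m (volume.restrict (Ioi (0 : ℝ)))
  exists_bound : ∃ C T : ℝ, 0 ≤ C ∧ ∀ u : ℝ, 0 < u → |m u|⁻¹ ≤ C * Real.exp (T * u ^ 2)

/-- The constant multiplier `1` is admissible. [folklore] -/
theorem isDivAdmissible_one : IsDivAdmissible fun _ : ℝ => (1 : ℝ) :=
  ⟨aestronglyMeasurable_const, 1, 0, zero_le_one, fun u _ ↦ by simp⟩

/-- The Laplace multiplier `1 + u²/a²` is admissible for every real `a` (it is `≥ 1`; for `a = 0`
it is the constant `1` by `x/0 = 0`). [folklore] -/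
theorem isDivAdmissible_laplace (a : ℝ) : IsDivAdmissible fun u : ℝ => 1 + u ^ 2 / a ^ 2 := by
  refine ⟨(by fun_prop : Continuous fun u : ℝ => 1 + u ^ 2 / a ^ 2).aestronglyMeasurable,
    1, 0, zero_le_one, fun u _ ↦ ?_⟩
  have h1 : (1 : ℝ) ≤ 1 + u ^ 2 / a ^ 2 := by
    have : 0 ≤ u ^ 2 / a ^ 2 := by positivity
    linarith
  rw [abs_of_pos (by linarith), zero_mul, Real.exp_zero, mul_one]
  exact inv_le_one_of_one_le₀ h1

/-- The Gaussian multiplier `e^{t u²}` is admissible for every real `t`. [folklore] -/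
theorem isDivAdmissible_exp (t : ℝ) : IsDivAdmissible fun u : ℝ => Real.exp (t * u ^ 2) := by
  refine ⟨(by fun_prop : Continuous fun u : ℝ => Real.exp (t * u ^ 2)).aestronglyMeasurable,
    1, -t, zero_le_one, fun u _ ↦ ?_⟩
  rw [abs_of_pos (Real.exp_pos _), ← Real.exp_neg, one_mul, neg_mul]

/-- Products of admissible multipliers are admissible. [folklore] -/
theorem IsDivAdmissible.mul {m₁ m₂ : ℝ → ℝ} (h₁ : IsDivAdmissible m₁) (h₂ : IsDivAdmissible m₂) :
    IsDivAdmissible fun u ↦ m₁ u * m₂ u := by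
  obtain ⟨C₁, T₁, hC₁, hb₁⟩ := h₁.exists_bound
  obtain ⟨C₂, T₂, hC₂, hb₂⟩ := h₂.exists_bound
  refine ⟨h₁.aestronglyMeasurable.mul h₂.aestronglyMeasurable, C₁ * C₂, T₁ + T₂,
    mul_nonneg hC₁ hC₂, fun u hu ↦ ?_⟩
  rw [abs_mul, mul_inv]
  calc |m₁ u|⁻¹ * |m₂ u|⁻¹ ≤ C₁ * Real.exp (T₁ * u ^ 2) * (C₂ * Real.exp (T₂ * u ^ 2)) :=
        mul_le_mul (hb₁ u hu) (hb₂ u hu) (by positivity) (by positivity)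
    _ = C₁ * C₂ * Real.exp ((T₁ + T₂) * u ^ 2) := by rw [add_mul, Real.exp_add]; ring

/-! ## Moments of `Φ/m` -/

/-- The weight `uᵏ Φ(u)/m(u)`. [folklore] -/
def divWeight (m : ℝ → ℝ) (k : ℕ) (u : ℝ) : ℝ :=
  u ^ k * (deBruijnPhi u / m u)

/-- The integrand `uᵏ (Φ/m)(u) cos(zu)`. [folklore] -/
def divCosIntegrand (m : ℝ → ℝ) (k : ℕ) (z : ℂ) (u : ℝ) : ℂ :=
  (divWeight m k u : ℂ) * Complex.cos (z * u)

/-- The integrand `uᵏ (Φ/m)(u) sin(zu)`. [folklore] -/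
def divSinIntegrand (m : ℝ → ℝ) (k : ℕ) (z : ℂ) (u : ℝ) : ℂ :=
  (divWeight m k u : ℂ) * Complex.sin (z * u)

/-- The cosine moment `∫₀^∞ uᵏ (Φ/m)(u) cos(zu) du` (`k = 0`: `deBruijnHDiv m`). [folklore] -/
def divCosMoment (m : ℝ → ℝ) (k : ℕ) (z : ℂ) : ℂ :=
  ∫ u in Ioi (0 : ℝ), divCosIntegrand m k z u

/-- The sine moment `∫₀^∞ uᵏ (Φ/m)(u) sin(zu) du`. [folklore] -/
def divSinMoment (m : ℝ → ℝ) (k : ℕ) (z : ℂ) : ℂ :=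
  ∫ u in Ioi (0 : ℝ), divSinIntegrand m k z u

/-- `divCosMoment m 0 = deBruijnHDiv m`. [folklore] -/
theorem divCosMoment_zero (m : ℝ → ℝ) (z : ℂ) : divCosMoment m 0 z = deBruijnHDiv m z := by
  rw [deBruijnHDiv, divCosMoment]
  refine setIntegral_congr_fun measurableSet_Ioi fun u _ ↦ ?_
  simp [divCosIntegrand, divWeight]

/-- `divWeight m (k+1) u = u · divWeight m k u`. [folklore] -/
theorem divWeight_succ (m : ℝ → ℝ) (k : ℕ) (u : ℝ) :
    divWeight m (k + 1) u = u * divWeight m k u := by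
  simp only [divWeight, pow_succ]; ring

/-- Domination of the weight: `|uᵏ Φ(u)/m(u)| e^{Yu} ≤ C e^{Tu²} |Φ(u)| e^{(Y+k)u}` for `u > 0`
when `|m(u)|⁻¹ ≤ C e^{Tu²}`. [folklore] -/
theorem abs_divWeight_mul_exp_le {m : ℝ → ℝ} {C T : ℝ}
    (hb : ∀ u : ℝ, 0 < u → |m u|⁻¹ ≤ C * Real.exp (T * u ^ 2)) (k : ℕ) (Y : ℝ) {u : ℝ}
    (hu : 0 < u) : |divWeight m k u| * Real.exp (Y * u) ≤ C * deBruijnHBound T (Y + k) u := by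
  rw [divWeight, abs_mul, abs_div, abs_of_nonneg (pow_nonneg hu.le k), deBruijnHBound, div_eq_mul_inv]
  have hk := pow_le_exp_nat_mul k hu.le
  calc u ^ k * (|deBruijnPhi u| * |m u|⁻¹) * Real.exp (Y * u)
      ≤ Real.exp (k * u) * (|deBruijnPhi u| * (C * Real.exp (T * u ^ 2))) * Real.exp (Y * u) := by
        gcongr
        exact hb u hu
    _ = C * (Real.exp (T * u ^ 2) * |deBruijnPhi u| * Real.exp ((Y + k) * u)) := by
        rw [add_mul, Real.exp_add]; ring

/-- Domination of the cosine integrand for `|Im z| ≤ Y`. [folklore] -/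
theorem norm_divCosIntegrand_le {m : ℝ → ℝ} {C T : ℝ}
    (hb : ∀ u : ℝ, 0 < u → |m u|⁻¹ ≤ C * Real.exp (T * u ^ 2)) (k : ℕ) {Y : ℝ} {z : ℂ}
    (hz : |z.im| ≤ Y) {u : ℝ} (hu : 0 < u) :
    ‖divCosIntegrand m k z u‖ ≤ C * deBruijnHBound T (Y + k) u := by
  rw [divCosIntegrand, norm_mul, Complex.norm_real, Real.norm_eq_abs]
  exact (mul_le_mul_of_nonneg_left (norm_cos_mul_le_exp hz hu.le) (abs_nonneg _)).trans
    (abs_divWeight_mul_exp_le hb k Y hu)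

/-- Domination of the sine integrand for `|Im z| ≤ Y`. [folklore] -/
theorem norm_divSinIntegrand_le {m : ℝ → ℝ} {C T : ℝ}
    (hb : ∀ u : ℝ, 0 < u → |m u|⁻¹ ≤ C * Real.exp (T * u ^ 2)) (k : ℕ) {Y : ℝ} {z : ℂ}
    (hz : |z.im| ≤ Y) {u : ℝ} (hu : 0 < u) :
    ‖divSinIntegrand m k z u‖ ≤ C * deBruijnHBound T (Y + k) u := by
  rw [divSinIntegrand, norm_mul, Complex.norm_real, Real.norm_eq_abs]
  exact (mul_le_mul_of_nonneg_left (norm_sin_mul_le_exp hz hu.le) (abs_nonneg _)).trans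
    (abs_divWeight_mul_exp_le hb k Y hu)

namespace IsDivAdmissible

variable {m : ℝ → ℝ}

/-- The weight `uᵏ Φ/m` is a.e. strongly measurable on `(0, ∞)`. [folklore] -/
theorem aestronglyMeasurable_divWeight (hm : IsDivAdmissible m) (k : ℕ) :
    AEStronglyMeasurable (divWeight m k) (volume.restrict (Ioi (0 : ℝ))) := by
  have h1 : AEStronglyMeasurable (fun u : ℝ ↦ u ^ k * deBruijnPhi u) (volume.restrict (Ioi 0)) :=
    (((continuous_pow k).continuousOn).mul
      (continuousOn_deBruijnPhi_Ici.mono Ioi_subset_Ici_self)).aestronglyMeasurable measurableSet_Ioi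
  have h2 : AEStronglyMeasurable (fun u : ℝ ↦ (m u)⁻¹) (volume.restrict (Ioi 0)) :=
    hm.aestronglyMeasurable.aemeasurable.inv.aestronglyMeasurable
  refine (h1.mul h2).congr (Eventually.of_forall fun u ↦ ?_)
  simp only [divWeight, Pi.mul_apply]; ring

/-- Measurability of the cosine integrand on `(0, ∞)`. [folklore] -/
theorem aestronglyMeasurable_divCosIntegrand (hm : IsDivAdmissible m) (k : ℕ) (z : ℂ) :
    AEStronglyMeasurable (divCosIntegrand m k z) (volume.restrict (Ioi (0 : ℝ))) :=
  (Complex.continuous_ofReal.comp_aestronglyMeasurable (hm.aestronglyMeasurable_divWeight k)).mul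
    (continuous_cos_const_mul z).aestronglyMeasurable

/-- Measurability of the sine integrand on `(0, ∞)`. [folklore] -/
theorem aestronglyMeasurable_divSinIntegrand (hm : IsDivAdmissible m) (k : ℕ) (z : ℂ) :
    AEStronglyMeasurable (divSinIntegrand m k z) (volume.restrict (Ioi (0 : ℝ))) :=
  (Complex.continuous_ofReal.comp_aestronglyMeasurable (hm.aestronglyMeasurable_divWeight k)).mul
    (Complex.continuous_sin.comp (continuous_const.mul Complex.continuous_ofReal)).aestronglyMeasurable

/-- The cosine moments converge absolutely. [folklore] -/
theorem integrableOn_divCosIntegrand (hm : IsDivAdmissible m) (k : ℕ) (z : ℂ) :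
    IntegrableOn (divCosIntegrand m k z) (Ioi (0 : ℝ)) := by
  obtain ⟨C, T, -, hb⟩ := hm.exists_bound
  exact ((integrableOn_deBruijnHBound T (|z.im| + k)).const_mul C).mono'
    (hm.aestronglyMeasurable_divCosIntegrand k z)
    (ae_restrict_of_forall_mem measurableSet_Ioi fun _ hu ↦ norm_divCosIntegrand_le hb k le_rfl hu)

/-- The sine moments converge absolutely. [folklore] -/
theorem integrableOn_divSinIntegrand (hm : IsDivAdmissible m) (k : ℕ) (z : ℂ) :
    IntegrableOn (divSinIntegrand m k z) (Ioi (0 : ℝ)) := by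
  obtain ⟨C, T, -, hb⟩ := hm.exists_bound
  exact ((integrableOn_deBruijnHBound T (|z.im| + k)).const_mul C).mono'
    (hm.aestronglyMeasurable_divSinIntegrand k z)
    (ae_restrict_of_forall_mem measurableSet_Ioi fun _ hu ↦ norm_divSinIntegrand_le hb k le_rfl hu)

/-- In particular the integral defining `deBruijnHDiv m z` converges absolutely. [folklore] -/
theorem integrableOn_deBruijnHDiv (hm : IsDivAdmissible m) (z : ℂ) :
    IntegrableOn (fun u : ℝ ↦ ((deBruijnPhi u / m u : ℝ) : ℂ) * Complex.cos (z * u)) (Ioi (0 : ℝ)) := by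
  refine (hm.integrableOn_divCosIntegrand 0 z).congr_fun (fun u _ ↦ ?_) measurableSet_Ioi
  simp [divCosIntegrand, divWeight]

end IsDivAdmissible

/-! ## Differentiation under the integral sign -/

/-- `∂_z [uᵏ (Φ/m) cos(zu)] = −u^{k+1} (Φ/m) sin(zu)`. [folklore] -/
theorem hasDerivAt_divCosIntegrand (m : ℝ → ℝ) (k : ℕ) (u : ℝ) (z : ℂ) :
    HasDerivAt (fun w : ℂ ↦ divCosIntegrand m k w u) (-divSinIntegrand m (k + 1) z u) z := by
  have h : HasDerivAt (fun w : ℂ ↦ divCosIntegrand m k w u)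
      ((divWeight m k u : ℂ) * (-Complex.sin (z * u) * u)) z :=
    ((hasDerivAt_mul_const (u : ℂ)).ccos).const_mul ((divWeight m k u : ℝ) : ℂ)
  refine h.congr_deriv ?_
  rw [divSinIntegrand, divWeight_succ]; push_cast; ring

/-- `∂_z [uᵏ (Φ/m) sin(zu)] = u^{k+1} (Φ/m) cos(zu)`. [folklore] -/
theorem hasDerivAt_divSinIntegrand (m : ℝ → ℝ) (k : ℕ) (u : ℝ) (z : ℂ) :
    HasDerivAt (fun w : ℂ ↦ divSinIntegrand m k w u) (divCosIntegrand m (k + 1) z u) z := by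
  have h : HasDerivAt (fun w : ℂ ↦ divSinIntegrand m k w u)
      ((divWeight m k u : ℂ) * (Complex.cos (z * u) * u)) z :=
    ((hasDerivAt_mul_const (u : ℂ)).csin).const_mul ((divWeight m k u : ℝ) : ℂ)
  refine h.congr_deriv ?_
  rw [divCosIntegrand, divWeight_succ]; push_cast; ring

namespace IsDivAdmissible

variable {m : ℝ → ℝ}

/-- `∂_z divCosMoment m k = −divSinMoment m (k+1)` for admissible `m`. [folklore] -/
theorem hasDerivAt_divCosMoment (hm : IsDivAdmissible m) (k : ℕ) (z₀ : ℂ) :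
    HasDerivAt (divCosMoment m k) (-divSinMoment m (k + 1) z₀) z₀ := by
  obtain ⟨C, T, -, hb⟩ := hm.exists_bound
  have h := (hasDerivAt_integral_of_dominated_loc_of_deriv_le (μ := volume.restrict (Ioi 0))
    (F := divCosIntegrand m k) (F' := fun w u ↦ -divSinIntegrand m (k + 1) w u) (x₀ := z₀)
    (bound := fun u ↦ C * deBruijnHBound T (|z₀.im| + 1 + (k + 1 : ℕ)) u)
    (Metric.ball_mem_nhds z₀ one_pos)
    (Eventually.of_forall fun z ↦ hm.aestronglyMeasurable_divCosIntegrand k z)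
    (hm.integrableOn_divCosIntegrand k z₀)
    ((hm.aestronglyMeasurable_divSinIntegrand (k + 1) z₀).neg)
    (ae_restrict_of_forall_mem measurableSet_Ioi fun _ hu _ hz ↦ by
      rw [norm_neg]
      exact norm_divSinIntegrand_le hb (k + 1) (abs_im_le_of_mem_ball hz) hu)
    ((integrableOn_deBruijnHBound _ _).const_mul C)
    (ae_restrict_of_forall_mem measurableSet_Ioi fun u _ z _ ↦
      hasDerivAt_divCosIntegrand m k u z)).2
  rw [integral_neg] at h
  exact h

/-- `∂_z divSinMoment m k = divCosMoment m (k+1)` for admissible `m`. [folklore] -/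
theorem hasDerivAt_divSinMoment (hm : IsDivAdmissible m) (k : ℕ) (z₀ : ℂ) :
    HasDerivAt (divSinMoment m k) (divCosMoment m (k + 1) z₀) z₀ := by
  obtain ⟨C, T, -, hb⟩ := hm.exists_bound
  exact (hasDerivAt_integral_of_dominated_loc_of_deriv_le (μ := volume.restrict (Ioi 0))
    (F := divSinIntegrand m k) (F' := fun w u ↦ divCosIntegrand m (k + 1) w u) (x₀ := z₀)
    (bound := fun u ↦ C * deBruijnHBound T (|z₀.im| + 1 + (k + 1 : ℕ)) u)
    (Metric.ball_mem_nhds z₀ one_pos)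
    (Eventually.of_forall fun z ↦ hm.aestronglyMeasurable_divSinIntegrand k z)
    (hm.integrableOn_divSinIntegrand k z₀)
    (hm.aestronglyMeasurable_divCosIntegrand (k + 1) z₀)
    (ae_restrict_of_forall_mem measurableSet_Ioi fun _ hu _ hz ↦
      norm_divCosIntegrand_le hb (k + 1) (abs_im_le_of_mem_ball hz) hu)
    ((integrableOn_deBruijnHBound _ _).const_mul C)
    (ae_restrict_of_forall_mem measurableSet_Ioi fun u _ z _ ↦
      hasDerivAt_divSinIntegrand m k u z)).2

/-- `deBruijnHDiv m` has derivative `−divSinMoment m 1 z = −∫₀^∞ u (Φ/m)(u) sin(zu) du`.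
[folklore] -/
theorem hasDerivAt_deBruijnHDiv (hm : IsDivAdmissible m) (z : ℂ) :
    HasDerivAt (deBruijnHDiv m) (-divSinMoment m 1 z) z := by
  have h := hm.hasDerivAt_divCosMoment 0 z
  have he : divCosMoment m 0 = deBruijnHDiv m := funext (divCosMoment_zero m)
  rwa [he] at h

/-- **`deBruijnHDiv m` is entire** for every admissible multiplier `m` (differentiation under
the integral sign; `Φ/m` has all exponential moments). [folklore] -/
theorem differentiable_deBruijnHDiv (hm : IsDivAdmissible m) : Differentiable ℂ (deBruijnHDiv m) :=
  fun z ↦ (hm.hasDerivAt_deBruijnHDiv z).differentiableAt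

/-- `(deBruijnHDiv m)' = −divSinMoment m 1`. [folklore] -/
theorem deriv_deBruijnHDiv (hm : IsDivAdmissible m) :
    deriv (deBruijnHDiv m) = fun z ↦ -divSinMoment m 1 z :=
  funext fun z ↦ (hm.hasDerivAt_deBruijnHDiv z).deriv

/-- `(deBruijnHDiv m)'' = −divCosMoment m 2 = −∫₀^∞ u² (Φ/m)(u) cos(zu) du`. [folklore] -/
theorem deriv_deriv_deBruijnHDiv (hm : IsDivAdmissible m) :
    deriv (deriv (deBruijnHDiv m)) = fun z ↦ -divCosMoment m 2 z := by
  rw [hm.deriv_deBruijnHDiv]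
  exact funext fun z ↦ ((hm.hasDerivAt_divSinMoment 1 z).neg).deriv

end IsDivAdmissible

/-! ## The Laplace multiplier: entirety and the ODE `F_a − F_a''/a² = H_0` -/

/-- The Laplace-smoothed transform `F_a = deBruijnHDiv (1 + u²/a²)` is entire, for every real `a`.
[folklore] -/
theorem differentiable_deBruijnHDiv_laplace (a : ℝ) :
    Differentiable ℂ (deBruijnHDiv fun u : ℝ => 1 + u ^ 2 / a ^ 2) :=
  (isDivAdmissible_laplace a).differentiable_deBruijnHDiv

/-- **The ODE of the Laplace smoothing** (route `UniversalFactor`, the identity behind item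
LaguerreLift): `F_a(z) − F_a''(z)/a² = H_0(z)` for every complex `z` and every real `a`, because
`F_a'' = −∫ u² Φ(u)/(1 + u²/a²) cos(zu) du` and `(Φ/m)·(1 + u²/a²) = Φ`. (For `a = 0` the
multiplier is `1` and `x/0 = 0`, so both sides are `H_0(z)`.) [folklore] -/
theorem deBruijnHDiv_laplace_sub_deriv_deriv (a : ℝ) (z : ℂ) :
    deBruijnHDiv (fun u : ℝ => 1 + u ^ 2 / a ^ 2) z -
        deriv (deriv (deBruijnHDiv fun u : ℝ => 1 + u ^ 2 / a ^ 2)) z / a ^ 2 = deBruijnH 0 z := by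
  set m : ℝ → ℝ := fun u ↦ 1 + u ^ 2 / a ^ 2 with hm_def
  have hm : IsDivAdmissible m := isDivAdmissible_laplace a
  have hm_pos : ∀ u : ℝ, 0 < m u := fun u ↦ by
    have : 0 ≤ u ^ 2 / a ^ 2 := by positivity
    simp only [hm_def]; linarith
  rw [hm.deriv_deriv_deBruijnHDiv, ← divCosMoment_zero]
  simp only [neg_div, sub_neg_eq_add]
  rw [divCosMoment, divCosMoment, ← integral_div, ← integral_add (hm.integrableOn_divCosIntegrand 0 z)
    ((hm.integrableOn_divCosIntegrand 2 z).div_const _), deBruijnH]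
  refine setIntegral_congr_fun measurableSet_Ioi fun u _ ↦ ?_
  have hmu : m u ≠ 0 := (hm_pos u).ne'
  have key : divWeight m 0 u + divWeight m 2 u / a ^ 2 = deBruijnPhi u := by
    simp only [divWeight, pow_zero, one_mul]
    rw [show deBruijnPhi u / m u + u ^ 2 * (deBruijnPhi u / m u) / a ^ 2 =
      deBruijnPhi u / m u * (1 + u ^ 2 / a ^ 2) by ring]
    exact div_mul_cancel₀ _ hmu
  simp only [divCosIntegrand, Real.exp_zero, zero_mul, Complex.ofReal_one, one_mul]
  rw [← key]
  push_cast
  ring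

end Literature.NumberTheory.LFunctions
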